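import Summits.QuantumFields.YangMills.Theorems.BalabanLadderROTSkewTorusDLR
import Summits.QuantumFields.YangMills.Theorems.LangevinControlUVOSLegsFromFemtoAndGapStubLowerAux
import HarnessLib

/-!
# Crux `ROT` (stmt-QuantumFields-20042): the tilt bracket at FIXED lattice is controlled by the boundary-condition oscillation
# of the cube kernels (two period cells, one specification)

Helper file of the fleet lead `ym-spine-20042-p1` (generation g4), `--supports stmt-QuantumFields-20042` (count-neutral).  Sequel of
`Theorems/BalabanLadderROTSkewTorusDLR.lean` (p480022: DLR equations for Wilson's measure on every period cell).

WHAT.  The tilt bracket `TI` of the split `KingOnClass ⇐ NROT3 ∧ TI` (`Theorems/BalabanLadderROTTiltSplit.lean`, p469977) is a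
difference of centred `n`-point moments `W_C(x) = ∫ ∏ᵢ (O(τ_{xᵢ}Ũ) − m_C) dμ_C` of the action density `O = r.curvature.F` on two
period cells `C₁` (tilted torus) and `C₂` (straight torus), each centred at its own mean `m_C = ∫ O(Ũ) dμ_C`.  Here, for ANY two
period cells of `ℤ⁴` and any finite edge set `Λ` such that `Λ`, the supports and `∂Λ` consist of representatives of both cells:

* §1 the product observable `P_m(U) = ∏ᵢ (O(τ_{xᵢ}U) − m)`: continuity, the bound `(B + |m|)ⁿ`, cylinder support; the moments are
  means of `P_m` (`moment_eq_mean_prod`); means of `B`-bounded observables are `B`-bounded; the reduction is injective on the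
  transversal (`injOn_red_reps`);
* §2 `abs_prod_sub_prod_le` (products of `n+1` factors bounded by `K` are `(n+1)Kⁿ`-Lipschitz in the sup norm of the factors) and
  the Lipschitz dependence of the moments on the centring, `abs_moment_sub_moment_centring_le`;
* §3 **`abs_moment_sub_moment_le`**: if the kernel averages `η ↦ γ_Λ(O | η)` and `η ↦ γ_Λ(P_{m₁} | η)` (`m₁ = C₁.mean O`) oscillate by at
  most `ε₀`, `ε₁` over all boundary conditions, then
  `|C₁.moment O (C₁.mean O) x − C₂.moment O (C₂.mean O) x| ≤ 2ε₁ + n(2B)ⁿ⁻¹·2ε₀`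
  (DLR on both cells, p480022 `abs_mean_sub_mean_le`, plus the centring correction).

So at fixed lattice the tilt bracket is bounded by boundary-condition oscillations of the lattice Yang–Mills kernels of ONE cube — the
quantity any infrared input (decay of boundary influence in physical units) controls; the passage along schemes (Riemann sums,
`a_k⁻⁴ⁿ` versus the oscillation) is the next file.  Nothing is asserted about the crux; no instance, no definition, no sorry.

References: H.-O. Georgii, *Gibbs Measures and Phase Transitions* (2011) (4.18); S. Friedli, Y. Velenik (2017) (6.34); C. King,
Commun. Math. Phys. 103 (1986) II (2.25) (the tilt bracket).
-/

set_option autoImplicit false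

noncomputable section

open scoped BigOperators ENNReal
open MeasureTheory Filter Topology Finset
open Literature.MathematicalPhysics.QuantumLattice
open Literature.MathematicalPhysics.QuantumFieldTheory (LatticeRep haarProbability continuous_configShift)
open Literature.Probability.LatticeModels (Site)
open Summit.QuantumFields.YangMills.Theorems.OSLegsFromFemtoAndGap.StubLower
  (isCylinder_curvature_shift continuous_curvature_shift exists_abs_curvature_le)

namespace Summit.QuantumFields.YangMills.Theorems.ROT

namespace PeriodCell

/-! ## §1 The product observable and the moments as means -/

section General

variable {d : ℕ} (C : PeriodCell d)

/-- The reduction of a period cell is injective on its transversal. -/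
theorem injOn_red_reps : Set.InjOn C.red (C.reps : Set (Site d)) := fun x hx y hy h => by
  rwa [C.red_eq_self x (mem_coe.1 hx), C.red_eq_self y (mem_coe.1 hy)] at h

/-- Injectivity of the reduction on any set of representatives. -/
theorem injOn_red_of_subset {B : Set (Site d)} (hB : B ⊆ (C.reps : Set (Site d))) : Set.InjOn C.red B :=
  C.injOn_red_reps.mono hB

variable {G : Type*} [Group G] {N : ℕ} (ρ : G →* Matrix (Fin N) (Fin N) ℂ)
  [TopologicalSpace G] [IsTopologicalGroup G] [CompactSpace G] [MeasurableSpace G] [BorelSpace G]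

/-- The centred moments are Wilson means of the product observable `U ↦ ∏ᵢ (O(τ_{xᵢ}U) − m)`. [folklore] -/
theorem moment_eq_mean_prod (β : ℝ) (O : LGConfig d G → ℝ) (m : ℝ) {n : ℕ} (x : Fin n → Site d) :
    C.moment (G := G) ρ β O m x = C.mean (G := G) ρ β (fun U => ∏ i, (O (configShift (-(x i)) U) - m)) := rfl

/-- The Wilson mean of an observable bounded by `B` is bounded by `B`. [folklore] -/
theorem abs_mean_le (hρ : Continuous ρ) (β : ℝ) {O : LGConfig d G → ℝ} {B : ℝ} (hB : ∀ U, |O U| ≤ B) :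
    |C.mean (G := G) ρ β O| ≤ B := by
  haveI := C.isProbabilityMeasure_measure (G := G) ρ hρ β
  have h := norm_integral_le_of_norm_le_const (μ := C.measure (G := G) ρ β) (f := fun U => O (C.lift U)) (C := B)
    (ae_of_all _ fun U => by rw [Real.norm_eq_abs]; exact hB _)
  rwa [Real.norm_eq_abs, probReal_univ, mul_one] at h

/-- Means of two integrable observables within `δ` of each other pointwise are within `δ`. [folklore] -/
theorem abs_mean_sub_mean_le_of_forall (hρ : Continuous ρ) (β : ℝ) {O O' : LGConfig d G → ℝ}
    (hO : Integrable (fun U => O (C.lift U)) (C.measure (G := G) ρ β))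
    (hO' : Integrable (fun U => O' (C.lift U)) (C.measure (G := G) ρ β))
    {δ : ℝ} (h : ∀ U, |O U - O' U| ≤ δ) :
    |C.mean (G := G) ρ β O - C.mean (G := G) ρ β O'| ≤ δ := by
  haveI := C.isProbabilityMeasure_measure (G := G) ρ hρ β
  unfold mean
  rw [← integral_sub hO hO']
  have hb := norm_integral_le_of_norm_le_const (μ := C.measure (G := G) ρ β)
    (f := fun U => O (C.lift U) - O' (C.lift U)) (C := δ) (ae_of_all _ fun U => by rw [Real.norm_eq_abs]; exact h _)
  rwa [Real.norm_eq_abs, probReal_univ, mul_one] at hb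

end General

/-! ## §2 Products are Lipschitz in their factors; the moments are Lipschitz in the centring -/

/-- **Products of `n+1` factors bounded by `K ≥ 0` are `(n+1)·Kⁿ`-Lipschitz in the sup norm of the factors.** [folklore] -/
theorem abs_prod_sub_prod_le : ∀ (n : ℕ) (f g : Fin (n + 1) → ℝ) (K δ : ℝ), 0 ≤ K →
    (∀ i, |f i| ≤ K) → (∀ i, |g i| ≤ K) → (∀ i, |f i - g i| ≤ δ) →
    |∏ i, f i - ∏ i, g i| ≤ (n + 1) * K ^ n * δ
  | 0, f, g, K, δ, _, _, _, hfg => by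
    simpa using hfg 0
  | n + 1, f, g, K, δ, hK, hf, hg, hfg => by
    have hδ : 0 ≤ δ := (abs_nonneg _).trans (hfg 0)
    rw [Fin.prod_univ_succ f, Fin.prod_univ_succ g]
    set P : ℝ := ∏ i : Fin (n + 1), f i.succ with hP
    set Q : ℝ := ∏ i : Fin (n + 1), g i.succ with hQ
    have ih : |P - Q| ≤ (n + 1) * K ^ n * δ :=
      abs_prod_sub_prod_le n (fun i => f i.succ) (fun i => g i.succ) K δ hK (fun i => hf _) (fun i => hg _) fun i => hfg _
    have hPK : |P| ≤ K ^ (n + 1) := by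
      -- `|∏ f| ≤ Kⁿ⁺¹` (cf. `Literature.Probability.LatticeModels.NVector.abs_prod_le_pow`)
      rw [hP, Finset.abs_prod]
      calc ∏ i : Fin (n + 1), |f i.succ| ≤ ∏ _i : Fin (n + 1), K :=
            Finset.prod_le_prod (fun i _ => abs_nonneg _) fun i _ => hf _
        _ = K ^ (n + 1) := by simp
    have e : f 0 * P - g 0 * Q = (f 0 - g 0) * P + g 0 * (P - Q) := by ring
    rw [e]
    calc |(f 0 - g 0) * P + g 0 * (P - Q)|
        ≤ |(f 0 - g 0) * P| + |g 0 * (P - Q)| := abs_add_le _ _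
      _ = |f 0 - g 0| * |P| + |g 0| * |P - Q| := by rw [abs_mul, abs_mul]
      _ ≤ δ * K ^ (n + 1) + K * ((n + 1) * K ^ n * δ) :=
          add_le_add (mul_le_mul (hfg 0) hPK (abs_nonneg _) hδ)
            (mul_le_mul (hg 0) ih (abs_nonneg _) hK)
      _ = (↑(n + 1) + 1) * K ^ (n + 1) * δ := by push_cast; ring

section Centring

variable {G : Type*} [Group G] {N : ℕ} (ρ : G →* Matrix (Fin N) (Fin N) ℂ)
  [TopologicalSpace G] [IsTopologicalGroup G] [CompactSpace G] [MeasurableSpace G] [BorelSpace G]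

omit [Group G] [TopologicalSpace G] [IsTopologicalGroup G] [CompactSpace G] [BorelSpace G] in
/-- The product observable with factors bounded by `B` and centring `|m| ≤ B` is bounded by `(2B)ⁿ`. [folklore] -/
theorem abs_prod_centred_le {d : ℕ} {O : LGConfig d G → ℝ} {B : ℝ} (hB : ∀ U, |O U| ≤ B) {m : ℝ} (hm : |m| ≤ B)
    {n : ℕ} (x : Fin n → Site d) (U : LGConfig d G) :
    |∏ i, (O (configShift (-(x i)) U) - m)| ≤ (2 * B) ^ n := by
  rw [Finset.abs_prod]
  calc ∏ i, |O (configShift (-(x i)) U) - m| ≤ ∏ _i : Fin n, (2 * B) :=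
        Finset.prod_le_prod (fun i _ => abs_nonneg _) fun i _ =>
          (abs_sub _ _).trans (by linarith [hB (configShift (-(x i)) U)])
    _ = (2 * B) ^ n := by simp

omit [Group G] [TopologicalSpace G] [IsTopologicalGroup G] [CompactSpace G] [BorelSpace G] in
/-- Pointwise Lipschitz dependence of the product observable on the centring: for `|m|, |m'| ≤ B` and factors bounded by `B`,
`|P_m(U) − P_{m'}(U)| ≤ n (2B)ⁿ⁻¹ |m − m'|`. [folklore] -/
theorem abs_prod_centred_sub_le {d : ℕ} {O : LGConfig d G → ℝ} {B : ℝ} (hB : ∀ U, |O U| ≤ B) {m m' : ℝ}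
    (hm : |m| ≤ B) (hm' : |m'| ≤ B) {n : ℕ} (x : Fin n → Site d) (U : LGConfig d G) :
    |∏ i, (O (configShift (-(x i)) U) - m) - ∏ i, (O (configShift (-(x i)) U) - m')| ≤
      n * (2 * B) ^ (n - 1) * |m - m'| := by
  rcases n with _ | n
  · simp
  · have hK : 0 ≤ 2 * B := by linarith [abs_nonneg m, hm]
    have h := abs_prod_sub_prod_le n (fun i => O (configShift (-(x i)) U) - m) (fun i => O (configShift (-(x i)) U) - m')
      (2 * B) |m - m'| hK (fun i => (abs_sub _ _).trans (by linarith [hB (configShift (-(x i)) U)]))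
      (fun i => (abs_sub _ _).trans (by linarith [hB (configShift (-(x i)) U)]))
      (fun i => by rw [show O (configShift (-(x i)) U) - m - (O (configShift (-(x i)) U) - m') = m' - m by ring, abs_sub_comm])
    simpa using h

variable {d : ℕ} (C : PeriodCell d)

/-- **The centred moments are Lipschitz in the centring**: for a continuous observable bounded by `B` and centrings
`|m|, |m'| ≤ B`, `|C.moment O m x − C.moment O m' x| ≤ n (2B)ⁿ⁻¹ |m − m'|`. [folklore] -/
theorem abs_moment_sub_moment_centring_le [SecondCountableTopology G] (hρ : Continuous ρ) (β : ℝ)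
    {O : LGConfig d G → ℝ} (hO : Continuous O) {B : ℝ} (hB : ∀ U, |O U| ≤ B) {m m' : ℝ} (hm : |m| ≤ B) (hm' : |m'| ≤ B)
    {n : ℕ} (x : Fin n → Site d) :
    |C.moment (G := G) ρ β O m x - C.moment (G := G) ρ β O m' x| ≤ n * (2 * B) ^ (n - 1) * |m - m'| := by
  haveI := C.isProbabilityMeasure_measure (G := G) ρ hρ β
  rw [moment_eq_mean_prod, moment_eq_mean_prod]
  have hc : ∀ m₀ : ℝ, Continuous fun U : C.Config G => ∏ i, (O (configShift (-(x i)) (C.lift U)) - m₀) := fun m₀ =>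
    continuous_finsetProd _ fun i _ => ((hO.comp (continuous_configShift _)).comp C.continuous_lift).sub continuous_const
  refine C.abs_mean_sub_mean_le_of_forall ρ hρ β
    (integrable_of_bound (hc m).aestronglyMeasurable fun U => abs_prod_centred_le hB hm x _)
    (integrable_of_bound (hc m').aestronglyMeasurable fun U => abs_prod_centred_le hB hm' x _)
    fun U => abs_prod_centred_sub_le hB hm hm' x U

end Centring

/-! ## §3 The tilt bracket at fixed lattice from boundary-condition oscillations of the cube kernels -/

section TwoCells

variable {G : Type} [Group G] [TopologicalSpace G] [IsTopologicalGroup G] [CompactSpace G]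
  [MeasurableSpace G] [BorelSpace G]

/-- The product of translated action densities is a cylinder observable on the union of the translated supports. -/
theorem isCylinder_prod_curvature_shift (r : LatticeRep G) (m : ℝ) {n : ℕ} (x : Fin n → Site 4) :
    IsCylinder (fun U : LGConfig 4 G => ∏ i, (r.curvature.F (configShift (-(x i)) U) - m))
      (Finset.univ.biUnion fun i => r.curvature.supp.image fun e => (e.1 + x i, e.2)) := by
  intro U V h
  refine Finset.prod_congr rfl fun i _ => ?_
  have hi : r.curvature.F (configShift (-(x i)) U) = r.curvature.F (configShift (-(x i)) V) :=
    isCylinder_curvature_shift r (x i)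
      (fun e he => h e (Finset.mem_coe.2 (Finset.mem_biUnion.2 ⟨i, Finset.mem_univ _, Finset.mem_coe.1 he⟩)))
  rw [hi]

/-- The product of translated action densities is continuous. -/
theorem continuous_prod_curvature_shift (r : LatticeRep G) (m : ℝ) {n : ℕ} (x : Fin n → Site 4) :
    Continuous fun U : LGConfig 4 G => ∏ i, (r.curvature.F (configShift (-(x i)) U) - m) :=
  continuous_finsetProd _ fun i _ => (continuous_curvature_shift r (x i)).sub continuous_const

/-- The action density is continuous (as `configShift (-0)` of itself). -/
theorem continuous_curvature (r : LatticeRep G) : Continuous r.curvature.F := by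
  have h := continuous_curvature_shift r 0
  have e : (fun U : LGConfig 4 G => r.curvature.F (configShift (-(0 : Site 4)) U)) = r.curvature.F := by
    funext U
    congr 1
    funext e'
    rw [configShift_apply, neg_zero, sub_zero]
  rwa [e] at h

/-- **The tilt bracket at fixed lattice.**  Let `C₁, C₂` be two period cells of `ℤ⁴` (e.g. the tilted and the straight torus of the
same side), `r` a lattice representation, `O = r.curvature.F` the action density (bounded by `B`), `x` an `n`-tuple of sites and `Λ` a
finite edge set such that the base points of `Λ`, of the support of `O`, of the translated supports at the `xᵢ` and of `∂Λ` are
representatives of BOTH cells.  If the kernel averages `η ↦ γ_Λ(O | η)` oscillate by at most `ε₀` and `η ↦ γ_Λ(P | η)` by at most `ε₁`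
over all boundary conditions, where `P(U) = ∏ᵢ (O(τ_{xᵢ}U) − C₁.mean O)`, then the centred moments of the two cells — each centred at
its own mean — satisfy `|W_{C₁}(x) − W_{C₂}(x)| ≤ 2ε₁ + n(2B)ⁿ⁻¹·(2ε₀)`. -/
theorem abs_moment_sub_moment_le (C₁ C₂ : PeriodCell 4) (r : LatticeRep G) (β : ℝ) (Λ : Finset (ZdEdge 4))
    {n : ℕ} (x : Fin n → Site 4) {B : ℝ} (hB : ∀ (z : Site 4) (U : LGConfig 4 G), |r.curvature.F (configShift (-z) U)| ≤ B)
    (h₁ : (((Λ ∪ (r.curvature.supp ∪ Finset.univ.biUnion fun i => r.curvature.supp.image fun e => (e.1 + x i, e.2)) ∪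
        (plaquettesTouching Λ).biUnion plaquetteEdges).image Prod.fst : Set (Site 4))) ⊆ (C₁.reps : Set (Site 4)))
    (h₂ : (((Λ ∪ (r.curvature.supp ∪ Finset.univ.biUnion fun i => r.curvature.supp.image fun e => (e.1 + x i, e.2)) ∪
        (plaquettesTouching Λ).biUnion plaquetteEdges).image Prod.fst : Set (Site 4))) ⊆ (C₂.reps : Set (Site 4)))
    {ε₀ ε₁ : ℝ}
    (hε₀ : ∀ η η' : LGConfig 4 G,
      |∫ W, r.curvature.F W ∂(ymSpecification r.ρ β Λ η) - ∫ W, r.curvature.F W ∂(ymSpecification r.ρ β Λ η')| ≤ ε₀)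
    (hε₁ : ∀ η η' : LGConfig 4 G,
      |∫ W, (∏ i, (r.curvature.F (configShift (-(x i)) W) - C₁.mean r.ρ β r.curvature.F)) ∂(ymSpecification r.ρ β Λ η) -
        ∫ W, (∏ i, (r.curvature.F (configShift (-(x i)) W) - C₁.mean r.ρ β r.curvature.F)) ∂(ymSpecification r.ρ β Λ η')| ≤ ε₁) :
    |C₁.moment r.ρ β r.curvature.F (C₁.mean r.ρ β r.curvature.F) x -
        C₂.moment r.ρ β r.curvature.F (C₂.mean r.ρ β r.curvature.F) x| ≤ 2 * ε₁ + n * (2 * B) ^ (n - 1) * (2 * ε₀) := by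
  haveI := r.secondCountableTopology
  set O : LGConfig 4 G → ℝ := r.curvature.F with hO_def
  set m₁ : ℝ := C₁.mean r.ρ β O with hm₁
  set m₂ : ℝ := C₂.mean r.ρ β O with hm₂
  -- bounds on `O` and on the two means
  have hOB : ∀ U, |O U| ≤ B := fun U => by
    have h := hB 0 U
    have e : configShift (-(0 : Site 4)) U = U := by
      funext e'; rw [configShift_apply, neg_zero, sub_zero]
    rwa [e] at h
  have hOc : Continuous O := continuous_curvature r
  have hm₁B : |m₁| ≤ B := C₁.abs_mean_le r.ρ r.continuous β hOB
  have hm₂B : |m₂| ≤ B := C₂.abs_mean_le r.ρ r.continuous β hOB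
  -- the supports, and the two injectivity hypotheses split
  set Sx : Finset (ZdEdge 4) := Finset.univ.biUnion fun i => r.curvature.supp.image fun e => (e.1 + x i, e.2) with hSx
  have hTO : ((Λ ∪ r.curvature.supp ∪ (plaquettesTouching Λ).biUnion plaquetteEdges).image Prod.fst : Set (Site 4)) ⊆
      ((Λ ∪ (r.curvature.supp ∪ Sx) ∪ (plaquettesTouching Λ).biUnion plaquetteEdges).image Prod.fst : Set (Site 4)) := by
    refine Finset.coe_subset.2 (Finset.image_subset_image ?_)
    exact Finset.union_subset_union (Finset.union_subset_union le_rfl Finset.subset_union_left) le_rfl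
  have hTP : ((Λ ∪ Sx ∪ (plaquettesTouching Λ).biUnion plaquetteEdges).image Prod.fst : Set (Site 4)) ⊆
      ((Λ ∪ (r.curvature.supp ∪ Sx) ∪ (plaquettesTouching Λ).biUnion plaquetteEdges).image Prod.fst : Set (Site 4)) := by
    refine Finset.coe_subset.2 (Finset.image_subset_image ?_)
    exact Finset.union_subset_union (Finset.union_subset_union le_rfl Finset.subset_union_right) le_rfl
  -- (a) the means: `|m₁ − m₂| ≤ 2ε₀`
  have hmm : |m₁ - m₂| ≤ 2 * ε₀ :=
    abs_mean_sub_mean_le r.ρ C₁ C₂ r.continuous β Λ hOc hOB r.curvature.isCylinder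
      (C₁.injOn_red_of_subset (hTO.trans h₁)) (C₂.injOn_red_of_subset (hTO.trans h₂)) hε₀
  -- (b) the product observable at the centring `m₁` on the two cells: `≤ 2ε₁`
  have hPB : ∀ U, |∏ i, (O (configShift (-(x i)) U) - m₁)| ≤ (2 * B) ^ n := fun U => abs_prod_centred_le hOB hm₁B x U
  have hPP : |C₁.mean r.ρ β (fun U => ∏ i, (O (configShift (-(x i)) U) - m₁)) -
      C₂.mean r.ρ β (fun U => ∏ i, (O (configShift (-(x i)) U) - m₁))| ≤ 2 * ε₁ :=
    abs_mean_sub_mean_le r.ρ C₁ C₂ r.continuous β Λ (continuous_prod_curvature_shift r m₁ x) hPB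
      (isCylinder_prod_curvature_shift r m₁ x)
      (C₁.injOn_red_of_subset (hTP.trans h₁)) (C₂.injOn_red_of_subset (hTP.trans h₂)) hε₁
  -- (c) the centring correction on `C₂`
  have hcorr : |C₂.moment r.ρ β O m₁ x - C₂.moment r.ρ β O m₂ x| ≤ n * (2 * B) ^ (n - 1) * |m₁ - m₂| :=
    C₂.abs_moment_sub_moment_centring_le r.ρ r.continuous β hOc hOB hm₁B hm₂B x
  -- assemble
  have hn0 : (0 : ℝ) ≤ n * (2 * B) ^ (n - 1) := by
    have hB0 : 0 ≤ 2 * B := by linarith [abs_nonneg m₁, hm₁B]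
    positivity
  rw [C₁.moment_eq_mean_prod r.ρ β O m₁ x] at *
  have e : C₁.mean r.ρ β (fun U => ∏ i, (O (configShift (-(x i)) U) - m₁)) - C₂.moment r.ρ β O m₂ x =
      (C₁.mean r.ρ β (fun U => ∏ i, (O (configShift (-(x i)) U) - m₁)) -
        C₂.mean r.ρ β (fun U => ∏ i, (O (configShift (-(x i)) U) - m₁))) +
      (C₂.moment r.ρ β O m₁ x - C₂.moment r.ρ β O m₂ x) := by
    rw [C₂.moment_eq_mean_prod r.ρ β O m₁ x]; ring
  rw [e]
  calc _ ≤ |C₁.mean r.ρ β (fun U => ∏ i, (O (configShift (-(x i)) U) - m₁)) -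
          C₂.mean r.ρ β (fun U => ∏ i, (O (configShift (-(x i)) U) - m₁))| +
        |C₂.moment r.ρ β O m₁ x - C₂.moment r.ρ β O m₂ x| := abs_add_le _ _
    _ ≤ 2 * ε₁ + n * (2 * B) ^ (n - 1) * |m₁ - m₂| := add_le_add hPP hcorr
    _ ≤ 2 * ε₁ + n * (2 * B) ^ (n - 1) * (2 * ε₀) := by
        have := mul_le_mul_of_nonneg_left hmm hn0
        linarith

end TwoCells

end PeriodCell

end Summit.QuantumFields.YangMills.Theorems.ROT

end
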